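import Literature.MathematicalPhysics.QuantumFieldTheory.Balaban1983to89.B8IdxB8LawsB
import Literature.MathematicalPhysics.QuantumFieldTheory.Balaban1983to89.B8LeafKnitZd3LettersRD
import Literature.MathematicalPhysics.QuantumFieldTheory.Balaban1983to89.B8LeafKnitZd3LettersRDB
import Literature.MathematicalPhysics.QuantumFieldTheory.Balaban1983to89.B8SockHFPCubeMemberRD
import Literature.MathematicalPhysics.QuantumFieldTheory.Balaban1983to89.B8Prop6CubeMemberGauged
import Literature.MathematicalPhysics.QuantumFieldTheory.Balaban1983to89.Node00.CarriersB8CubeSub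

/-!
# BalabanUVNodes ∕ N05 ([B8], `Dag.B8_main`) — THE N05 KNIT OVER THE BOND-LAW SUB-INDEX OF RECORD `B8IdxB8LawsB.IdxB8SubB θ`, LETTERS CURRENCY ON PRINT'S DOMAINS:
# the surviving [B8] leaf over `fun j : IdxB8SubB θ => famB8OfRecordSubB θ β len j` from [4]'s two letters families (existence side `SockLettersRD`, uniqueness side
# `SLetU`), the b9 socket and the printed members — ALL KEYED ON THE LAW `IdxB8LawsB θ.L i` (dag-lead REBALANCE №55 (d) ∕ №56 (a); director LINE №105)

Track A of `YM-PLAN.md` (cell `pub-ymgap`, HUMAN RULING D-0062), node **N05** = [Balaban1985RegularSpaces] Lemma 1, Thm 2, Prop 3, Thm 4, Props 5–7, Thm 8; R134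
fan-out seat `pub-ymgap-dag-n05-d` (g2; strategy s2 = BY-NAME KNIT at the record).  Sequel of this seat's `BalabanUVNodesN05AtRecord11Sub` v1.1 §4
(`b8LeafOfRecordSub_of_knit_lettersE`, p459742): that face binds the b9 socket `SB9all` and the letters over g32's sub-index `IdxB8Sub θ` (laws №7 ∕ №8 ∕ №11), where
(J2′, dag-ref-A g12, kernel-certified `sb9all_false`; n05-c's `exists_idxB8Sub_not_lawsB`) members with EMPTY bond classes make the `SB9all` family unsatisfiable, and it
binds the FULL-SPACE letters socket `SockLetters` (W8∕W8′: unsatisfiable at finite `Ω₀`).  n05-c g2's `B8IdxB8LawsB` (p465406) adds the bond law №12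
(`i.Λb m j = towerBonds L i.Ω (i.Λs m) j`, the classes 𝔅 of p. 86 GENERATED by the Λ-tower of p. 81) and the sub-index `IdxB8SubB θ` with its family `famB8OfRecordSubB`
(`not_idxB8LawsB_of_bonds_empty`: the J2′ witnesses are excluded; `B8TowerBondsNonempty`: the bond subtype is inhabited); this seat's `B8LeafKnitZd3LettersRD` (p467425)
is the ι-generic knit with the existence letters on print's domains (`SockLettersRD`) and the uniqueness socket discharged from `SLetU` (n04-b's
`exists_threshold_sockP5uE`).  THIS MODULE instantiates it at `ι := fun j : IdxB8SubB θ => j.1.1` with the member laws read off `j.2` — the N05 input of the (future)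
re-keyed slot `B8LeafOfRecordSubB` ∕ six-pin record over `IdxB8SubB` (pin owner's; when it is defined as the `B8LeafRS` below, this theorem closes it by `rfl`).
Kernel bookkeeping: 0 `def`, 0 `sorry`, standard axioms.  COUNT-NEUTRAL; `--supports` K1 (stmt-QuantumFields-19674).

WHAT THIS MODULE PROVES.
* **`b8LeafRS_subB_of_knit_lettersRDU`** — the surviving [B8] leaf `B8LeafRS θ.D θ.L λ.C₂ λ.B₁′ λ.inp.B₀′ λ.B₁ λ.B₂ λ.c₁ λ.inp λ.B₀β (blockPairNA θ.D θ.L θ.𝔸)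
  (fun j : IdxB8SubB θ => famB8OfRecordSubB θ λ.β λ.len j) λ.lan λ.cub (fun j => λ.toAxial j.1)` for a residual layer `λ : ResidB8 θ` with `λ.B₁′ = 5dL·B₀`, from, AT EVERY
  MEMBER SATISFYING `IdxB8LawsB θ.L i` ONLY: the existence letters `SockLettersRD θ.L B_G B_R B₀′_H B₂′ c_L` ([4] Thms 3.1–3.3, laws on print's domains), the uniqueness
  letters `SLetU` (n04-b's twelve laws at the top structure), the b9 socket `SB9all` ([4] Thm 3.3 in Prop. 3's frame); plus `3·(2dL²)·B_G·B_R ≤ λ.inp.B₀′` and the printed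
  members `p5e p5u p6 p7 t8S` over `IdxB8SubB θ`.  No Proposition-5 socket; no binder ranges over a J2′ member.
* **`b8LeafRS_subB_of_knit_lettersRDU_bonds`** — the same with the b9 socket asked at the GENERATED bond classes `towerBonds θ.L i.Ω (i.Λs m)` (the shape a supplier keyed
  on the Λ-tower serves; rewritten into `i.Λb` by `IdxB8LawsB.bonds`).

VERSION v1.1 (same seat, APPEND-ONLY §2): **`exists_c₁_b8LeafRS_subB_cut_of_knit_lettersRDU`** — the same knit with PROPOSITION 6's letter `p6` DISCHARGED as well, at
node00-def-cube's law-cut Proposition-6 slot (the cube family of record `fun j : IdxB8SubB θ => cubB8OfRecord θ j.1` = `(λ.withCubOn (IdxB8LawsB θ.L ·.1)).cub`,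
`Node00/CarriersB8CubeSub`): for SOME `c₁ > 0` (print's «there exists c₁», Prop. 6 p. 99) the surviving leaf holds with Prop. 6 read at that cube family, from
the law-member sockets of §1 PLUS, at EVERY CUBE `c : CubeB8` of every law member, the existence letters `SockLettersRD` and the b9 socket at the CUBE geometry
`(□_j, its collars, their bonds)` (`cubeFam`∕`cubeLamS`∕`cubeLamB` at spacing `i.η`) — composed from n05-c's `sockHFP_pair_cubeMemberRD` (p≈467xxx,
`B8SockHFPCubeMemberRD`), n05-a's `sockH59_of_allLevels`, n05-e's `prop6Printed_zdCub₃` (`B8Prop6CubeMemberGauged`) and node00-def-cube's monotonicity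
`prop6Printed_zdCub_mono`; remaining printed members: `p5e p5u p7 t8S`.

HONEST FRAMING.  [B8]'s theorems are NOT proved here for Bałaban's objects; [4] Thms 3.1–3.3 (both letters families) and [4] Thm 3.3-in-Prop-3's-frame (`SB9all`) are
HYPOTHESES at the law members, `p5e p5u p6 p7 t8S` are hypotheses; N05 is NOT discharged (typed 28∕28, discharged 5∕27 untouched); one finite four-torus programme at
fixed `ε` — NOT ℝ⁴, NOT infinite volume, NOT OS, NOT a mass gap, NOT Clay.  Restate-immune (no `def`).
-/

noncomputable section

namespace Summit.QuantumFields.YangMills.BalabanUVNodes.N05SubBKnit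

open Literature.MathematicalPhysics.QuantumFieldTheory.Balaban1983to89
open Literature.MathematicalPhysics.QuantumFieldTheory.Balaban1983to89.Node00
open Literature.MathematicalPhysics.QuantumFieldTheory.Balaban1983to89.B8IdxB8LawsB (towerBonds IdxB8LawsB IdxB8SubB famB8OfRecordSubB)
open Literature.MathematicalPhysics.QuantumFieldTheory.Balaban1983to89.B8LeafModelZd (ZdIdx)
open Literature.MathematicalPhysics.QuantumFieldTheory.Balaban1983to89.B8LeafModelZd3 (SockB9P3)
open Literature.MathematicalPhysics.QuantumFieldTheory.Balaban1983to89.B8SockLettersRD (SockLettersRD)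
open Literature.MathematicalPhysics.QuantumFieldTheory.Balaban1983to89.B8LeafKnitRS (B8LeafRS)
open Literature.MathematicalPhysics.QuantumFieldTheory.Balaban1983to89.B8Lemma1NonAbelian (blockPairNA)
open Literature.MathematicalPhysics.QuantumFieldTheory.Balaban1983to89.B8LeafKnitZd3LettersRD (b8LeafRS_zd3_map_lettersRDU)
open B7Prop1Explicit B7Prop2Explicit B7Prop1Local
open B8Ineq132 (InAk covDerivFwd)
open B7Eq78Linearization (zdBlocking QprimeIter)
open B8Eq119TwistedAxial (bgT)
open B8Eq140Level (SideTouches)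
open B8Eq138LandauZd (covLap QT)
open B8Eq1117Concrete (XSpace)
open B8Prop5ContractionKLevel (Bd2)
open B8LambdaSpaceKLevel (wt)

section KnitSubB

/-- **THE SURVIVING [B8] LEAF OVER THE BOND-LAW SUB-INDEX OF RECORD FROM [4]'s LETTERS** — for a residual layer `λ : ResidB8 θ` with `λ.B₁′ = 5dL·B₀`, `2 ≤ 5dL·B₀`, `B₀(β₀) > 0`,
`C₂ ≥ 2097152(d+1)²`, [4]-letters constants `B₀′_H > 0`, `B₂′, B_G, B_R ≥ 0` with threshold `c_L > 0`, b9 threshold `c_b9 > 0`, the free-constant condition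
`3·(2dL²)·B_G·B_R ≤ λ.inp.B₀′`, and — AT EVERY MEMBER `i` WITH `IdxB8LawsB θ.L i` (laws №7 №8 №11 №12: in particular `i.Λb` is GENERATED by the Λ-tower, so no J2′ member is in
range) — the existence letters `SockLettersRD` (laws on print's domains: [4] Thm 3.1's `G′` inverts the Dirichlet operator pointwise on `Ω₀`; (3.25)'s `C` on the range of `Q′`),
the uniqueness letters `SLetU` (n04-b's twelve laws at the top structure `(i.k, i.Λs i.k)`), the b9 socket at every truncation; plus the printed members `p5e p5u p6 p7 t8S` over
`IdxB8SubB θ`: the surviving leaf over `fun j : IdxB8SubB θ => famB8OfRecordSubB θ λ.β λ.len j`.  Proof: `B8LeafKnitZd3LettersRD.b8LeafRS_zd3_map_lettersRDU` at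
`ι := fun j : IdxB8SubB θ => j.1.1`, `Ω₀ = ℤᵈ` by `j.1.2`, laws (L1)∕(L2) by `IdxB8SubB.tower_all` ∕ `j.2.trunc_lt` ∕ `j.2.trunc_top`.  NOT a discharge of N05.
[cite: Balaban1985RegularSpaces, Lemma 1 p.79, Thm 2 p.83, Prop. 3 p.87, Thm 4 p.88, Prop. 5 (1.106)–(1.109) p.94, p.86 («𝔅_k»); Prop. 6 p.99, Prop. 7 p.100, Thm 8 p.101 (named hypotheses); Balaban1985BackgroundPropagators, Thm 3.1 p.397, (3.25) p.394, Thms 3.2–3.3 pp.397–398 (the letters, hypotheses)] -/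
theorem b8LeafRS_subB_of_knit_lettersRDU {θ : Stage3Params} (lam : ResidB8 θ) (hD : 2 ≤ θ.D) (hB₁' : lam.B₁' = 5 * (θ.D : ℝ) * θ.L * lam.inp.B₀)
    {cB9 B₀'H B₂' BG BR cL : ℝ} (hB : 2 ≤ 5 * (θ.D : ℝ) * θ.L * lam.inp.B₀) (hB₀β : 0 < lam.B₀β) (hC₂ : 2097152 * ((θ.D : ℝ) + 1) ^ 2 ≤ lam.C₂)
    (hcB9 : 0 < cB9) (hB₀'H : 0 < B₀'H) (hB₂' : 0 ≤ B₂') (hBG : 0 ≤ BG) (hBR : 0 ≤ BR) (hcL : 0 < cL)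
    (hfree : 3 * (2 * (θ.D : ℝ) * (θ.L : ℝ) ^ 2) * BG * BR ≤ lam.inp.B₀')
    -- [4]'s letters at the LAW members only: existence side (laws on print's domains) and uniqueness side (n04-b's twelve laws at the top structure)
    (SLet : ∀ i : ZdIdx θ.D θ.L, IdxB8LawsB θ.L i → SockLettersRD (𝔸 := θ.𝔸) θ.L BG BR B₀'H B₂' cL i.η i.k i.Ω i.Λs)
    (SLetU : ∀ i : ZdIdx θ.D θ.L, IdxB8LawsB θ.L i → ∀ α₀ : ℝ, 0 < α₀ → α₀ ≤ cL → ∀ U₀ : Site θ.D → Fin θ.D → θ.𝔸ˣ, (∀ x κ, U₀ x κ ∈ unitaryUnits θ.𝔸) →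
      InAk θ.L i.k i.η α₀ i.Ω U₀ →
      ∃ (g Δ : (Site θ.D → θ.𝔸) →ₗ[ℂ] (Site θ.D → θ.𝔸)) (q : (Site θ.D → θ.𝔸) →ₗ[ℂ] (ℕ → Site θ.D → θ.𝔸))
        (qs : (ℕ → Site θ.D → θ.𝔸) →ₗ[ℂ] (Site θ.D → θ.𝔸)) (Aw c : (ℕ → Site θ.D → θ.𝔸) →ₗ[ℂ] (ℕ → Site θ.D → θ.𝔸))
        (H' : XSpace θ.D i.k θ.𝔸 →ₗ[ℂ] (Site θ.D → θ.𝔸)),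
        (∀ x, g (Δ x + qs (Aw (q x))) = x) ∧ (∀ φ, qs (c (q (g (g (qs φ))))) = qs φ) ∧
        (∀ (f : Site θ.D → θ.𝔸), ∀ x ∈ i.Ω 0, Δ f x = covLap i.η U₀ ((i.Ω 0).indicator f) x) ∧
        (∀ (μ : ℕ → Site θ.D → θ.𝔸), ∀ x ∈ i.Ω 0, qs μ x = QT θ.L i.k (i.Λs i.k) U₀ μ x) ∧
        (∀ (f : Site θ.D → θ.𝔸) (n : ℕ), n ≤ i.k → ∀ y ∈ i.Λs i.k n, q f n y = QprimeIter (zdBlocking θ.D θ.L) (bgT θ.L U₀) n f y) ∧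
        (∀ (f : Site θ.D → θ.𝔸) (n : ℕ) (y : Site θ.D), ¬ (n ≤ i.k ∧ y ∈ i.Λs i.k n) → q f n y = 0) ∧
        (∀ (X : XSpace θ.D i.k θ.𝔸) (x : Site θ.D), ‖H' X x‖ ≤ B₀'H * ‖X‖) ∧
        (∀ n, n ≤ i.k → ∀ (X : XSpace θ.D i.k θ.𝔸), ∀ p ∈ {b : Site θ.D × Fin θ.D | SideTouches (i.Ω n) b.1 b.2},
          wt θ.L i.η n * ‖covDerivFwd i.η U₀ p.2 (H' X) p.1‖ ≤ B₀'H * ‖X‖) ∧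
        (∀ X : XSpace θ.D i.k θ.𝔸, Bd2 θ.L i.η i.k i.Ω (covLap i.η U₀ (H' X)) (B₂' * ‖X‖)) ∧
        (∀ (Y : XSpace θ.D i.k θ.𝔸) (n : ℕ) (hn : n ≤ i.k) (y : Site θ.D), y ∈ i.Λs i.k n →
          QprimeIter (zdBlocking θ.D θ.L) (bgT θ.L U₀) n (H' Y) y = Y (⟨n, Nat.lt_succ_of_le hn⟩, y)) ∧
        (∀ (f : Site θ.D → θ.𝔸) (r : ℝ), 0 ≤ r → Bd2 θ.L i.η i.k i.Ω f r →
          (∀ x, ‖g f x‖ ≤ BG * r) ∧ ∀ n, n ≤ i.k → ∀ p ∈ {b : Site θ.D × Fin θ.D | SideTouches (i.Ω n) b.1 b.2},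
            wt θ.L i.η n * ‖covDerivFwd i.η U₀ p.2 (g f) p.1‖ ≤ BG * r) ∧
        (∀ (f : Site θ.D → θ.𝔸) (r : ℝ), 0 ≤ r → Bd2 θ.L i.η i.k i.Ω f r → Bd2 θ.L i.η i.k i.Ω (f - g (qs (c (q (g f))))) (BR * r)))
    -- the b9 socket at every truncation, at the LAW members only ([4] Thm 3.3 in Prop. 3's frame; the bond classes are generated by the tower there)
    (SB9all : ∀ i : ZdIdx θ.D θ.L, IdxB8LawsB θ.L i → ∀ m, m ≤ i.k →
      SockB9P3 (𝔸 := θ.𝔸) θ.L lam.inp.B₀ lam.B₀β cB9 lam.β lam.len i.η m i.Ω i.Λs i.Λb)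
    -- the five printed members over the bond-law sub-index
    (p5e : B8.Prop5Exists lam.inp.B₀' lam.B₁ lam.lan) (p5u : B8.Prop5Unique lam.lan) (p6 : B8.Prop6Printed θ.D (θ.L : ℝ) lam.B₁ lam.c₁ lam.cub)
    (p7 : B8SectGH.Prop7PrintedR (fun j : IdxB8SubB θ => famB8OfRecordSubB θ lam.β lam.len j) (fun j => lam.toAxial j.1))
    (t8 : B8Thm8Surviving.Thm8SurvivingAt 1 lam.B₁ lam.B₂ (fun j : IdxB8SubB θ => famB8OfRecordSubB θ lam.β lam.len j)) :
    B8LeafRS θ.D (θ.L : ℝ) lam.C₂ lam.B₁' lam.inp.B₀' lam.B₁ lam.B₂ lam.c₁ lam.inp lam.B₀β (blockPairNA θ.D θ.L θ.𝔸)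
      (fun j : IdxB8SubB θ => famB8OfRecordSubB θ lam.β lam.len j) lam.lan lam.cub (fun j => lam.toAxial j.1) := by
  rw [hB₁']
  exact b8LeafRS_zd3_map_lettersRDU hD θ.two_le_L θ.L lam.β lam.len lam.inp hB hB₀β hC₂ hcB9 hB₀'H hB₂' hBG hBR hcL hfree
    (fun j : IdxB8SubB θ => j.1.1) (fun j => j.1.2) (fun j => IdxB8SubB.tower_all j) (fun j => j.2.trunc_lt) (fun j => j.2.trunc_top)
    (fun j => SLet j.1.1 j.2) (fun j => SLetU j.1.1 j.2) (fun j => SB9all j.1.1 j.2) p5e p5u p6 p7 t8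

/-- **THE SAME WITH THE b9 SOCKET ASKED AT THE GENERATED BOND CLASSES** — `SB9allT : … SockB9P3 … m i.Ω i.Λs (fun m j => towerBonds θ.L i.Ω (i.Λs m) j)` (the classes
𝔅 determined by the Λ-tower, p. 81∕p. 86 — the shape a supplier keyed on the tower serves), rewritten into the member's own `i.Λb` by the bond law №12 (`IdxB8LawsB.bonds`).
NOT a discharge of N05. [cite: Balaban1985RegularSpaces, p.81 (the Λ-tower), p.86 («𝔅_k»), Lemma 1 – Thm 8 pp.79–101; Balaban1985BackgroundPropagators, Thms 3.1–3.3 pp.397–398] -/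
theorem b8LeafRS_subB_of_knit_lettersRDU_bonds {θ : Stage3Params} (lam : ResidB8 θ) (hD : 2 ≤ θ.D) (hB₁' : lam.B₁' = 5 * (θ.D : ℝ) * θ.L * lam.inp.B₀)
    {cB9 B₀'H B₂' BG BR cL : ℝ} (hB : 2 ≤ 5 * (θ.D : ℝ) * θ.L * lam.inp.B₀) (hB₀β : 0 < lam.B₀β) (hC₂ : 2097152 * ((θ.D : ℝ) + 1) ^ 2 ≤ lam.C₂)
    (hcB9 : 0 < cB9) (hB₀'H : 0 < B₀'H) (hB₂' : 0 ≤ B₂') (hBG : 0 ≤ BG) (hBR : 0 ≤ BR) (hcL : 0 < cL)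
    (hfree : 3 * (2 * (θ.D : ℝ) * (θ.L : ℝ) ^ 2) * BG * BR ≤ lam.inp.B₀')
    (SLet : ∀ i : ZdIdx θ.D θ.L, IdxB8LawsB θ.L i → SockLettersRD (𝔸 := θ.𝔸) θ.L BG BR B₀'H B₂' cL i.η i.k i.Ω i.Λs)
    (SLetU : ∀ i : ZdIdx θ.D θ.L, IdxB8LawsB θ.L i → ∀ α₀ : ℝ, 0 < α₀ → α₀ ≤ cL → ∀ U₀ : Site θ.D → Fin θ.D → θ.𝔸ˣ, (∀ x κ, U₀ x κ ∈ unitaryUnits θ.𝔸) →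
      InAk θ.L i.k i.η α₀ i.Ω U₀ →
      ∃ (g Δ : (Site θ.D → θ.𝔸) →ₗ[ℂ] (Site θ.D → θ.𝔸)) (q : (Site θ.D → θ.𝔸) →ₗ[ℂ] (ℕ → Site θ.D → θ.𝔸))
        (qs : (ℕ → Site θ.D → θ.𝔸) →ₗ[ℂ] (Site θ.D → θ.𝔸)) (Aw c : (ℕ → Site θ.D → θ.𝔸) →ₗ[ℂ] (ℕ → Site θ.D → θ.𝔸))
        (H' : XSpace θ.D i.k θ.𝔸 →ₗ[ℂ] (Site θ.D → θ.𝔸)),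
        (∀ x, g (Δ x + qs (Aw (q x))) = x) ∧ (∀ φ, qs (c (q (g (g (qs φ))))) = qs φ) ∧
        (∀ (f : Site θ.D → θ.𝔸), ∀ x ∈ i.Ω 0, Δ f x = covLap i.η U₀ ((i.Ω 0).indicator f) x) ∧
        (∀ (μ : ℕ → Site θ.D → θ.𝔸), ∀ x ∈ i.Ω 0, qs μ x = QT θ.L i.k (i.Λs i.k) U₀ μ x) ∧
        (∀ (f : Site θ.D → θ.𝔸) (n : ℕ), n ≤ i.k → ∀ y ∈ i.Λs i.k n, q f n y = QprimeIter (zdBlocking θ.D θ.L) (bgT θ.L U₀) n f y) ∧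
        (∀ (f : Site θ.D → θ.𝔸) (n : ℕ) (y : Site θ.D), ¬ (n ≤ i.k ∧ y ∈ i.Λs i.k n) → q f n y = 0) ∧
        (∀ (X : XSpace θ.D i.k θ.𝔸) (x : Site θ.D), ‖H' X x‖ ≤ B₀'H * ‖X‖) ∧
        (∀ n, n ≤ i.k → ∀ (X : XSpace θ.D i.k θ.𝔸), ∀ p ∈ {b : Site θ.D × Fin θ.D | SideTouches (i.Ω n) b.1 b.2},
          wt θ.L i.η n * ‖covDerivFwd i.η U₀ p.2 (H' X) p.1‖ ≤ B₀'H * ‖X‖) ∧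
        (∀ X : XSpace θ.D i.k θ.𝔸, Bd2 θ.L i.η i.k i.Ω (covLap i.η U₀ (H' X)) (B₂' * ‖X‖)) ∧
        (∀ (Y : XSpace θ.D i.k θ.𝔸) (n : ℕ) (hn : n ≤ i.k) (y : Site θ.D), y ∈ i.Λs i.k n →
          QprimeIter (zdBlocking θ.D θ.L) (bgT θ.L U₀) n (H' Y) y = Y (⟨n, Nat.lt_succ_of_le hn⟩, y)) ∧
        (∀ (f : Site θ.D → θ.𝔸) (r : ℝ), 0 ≤ r → Bd2 θ.L i.η i.k i.Ω f r →
          (∀ x, ‖g f x‖ ≤ BG * r) ∧ ∀ n, n ≤ i.k → ∀ p ∈ {b : Site θ.D × Fin θ.D | SideTouches (i.Ω n) b.1 b.2},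
            wt θ.L i.η n * ‖covDerivFwd i.η U₀ p.2 (g f) p.1‖ ≤ BG * r) ∧
        (∀ (f : Site θ.D → θ.𝔸) (r : ℝ), 0 ≤ r → Bd2 θ.L i.η i.k i.Ω f r → Bd2 θ.L i.η i.k i.Ω (f - g (qs (c (q (g f))))) (BR * r)))
    -- the b9 socket at every truncation, at the LAW members, asked at the GENERATED bond classes
    (SB9allT : ∀ i : ZdIdx θ.D θ.L, IdxB8LawsB θ.L i → ∀ m, m ≤ i.k →
      SockB9P3 (𝔸 := θ.𝔸) θ.L lam.inp.B₀ lam.B₀β cB9 lam.β lam.len i.η m i.Ω i.Λs (fun m j => towerBonds θ.L i.Ω (i.Λs m) j))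
    (p5e : B8.Prop5Exists lam.inp.B₀' lam.B₁ lam.lan) (p5u : B8.Prop5Unique lam.lan) (p6 : B8.Prop6Printed θ.D (θ.L : ℝ) lam.B₁ lam.c₁ lam.cub)
    (p7 : B8SectGH.Prop7PrintedR (fun j : IdxB8SubB θ => famB8OfRecordSubB θ lam.β lam.len j) (fun j => lam.toAxial j.1))
    (t8 : B8Thm8Surviving.Thm8SurvivingAt 1 lam.B₁ lam.B₂ (fun j : IdxB8SubB θ => famB8OfRecordSubB θ lam.β lam.len j)) :
    B8LeafRS θ.D (θ.L : ℝ) lam.C₂ lam.B₁' lam.inp.B₀' lam.B₁ lam.B₂ lam.c₁ lam.inp lam.B₀β (blockPairNA θ.D θ.L θ.𝔸)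
      (fun j : IdxB8SubB θ => famB8OfRecordSubB θ lam.β lam.len j) lam.lan lam.cub (fun j => lam.toAxial j.1) := by
  refine b8LeafRS_subB_of_knit_lettersRDU lam hD hB₁' hB hB₀β hC₂ hcB9 hB₀'H hB₂' hBG hBR hcL hfree SLet SLetU (fun i hi m hm => ?_) p5e p5u p6 p7 t8
  have hb : i.Λb = fun m j => towerBonds θ.L i.Ω (i.Λs m) j := funext fun m => funext fun j => hi.bonds m j
  rw [hb]
  exact SB9allT i hi m hm

end KnitSubB

/-! ## §2 (v1.1) Proposition 6's letter DISCHARGED at the law-cut cube slot, from per-cube sockets -/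

section KnitSubBCube

open Literature.MathematicalPhysics.QuantumFieldTheory.Balaban1983to89.B8Eq131CubesAdmissible (cubeFam)
open Literature.MathematicalPhysics.QuantumFieldTheory.Balaban1983to89.B8CubeMemberZd (cubeLamS cubeLamB)
open Literature.MathematicalPhysics.QuantumFieldTheory.Balaban1983to89.B8SockHFPCubeMemberRD (sockHFP_pair_cubeMemberRD)
open Literature.MathematicalPhysics.QuantumFieldTheory.Balaban1983to89.B8Prop6CubeMemberGauged (prop6Printed_zdCub₃)
open Literature.MathematicalPhysics.QuantumFieldTheory.Balaban1983to89.B8LeafSocketsB9 (sockH59_of_allLevels)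

/-- **THE N05 KNIT OVER THE BOND-LAW SUB-INDEX WITH PROPOSITION 6 DISCHARGED AT THE LAW-CUT CUBE SLOT** — for a residual layer `λ : ResidB8 θ` with `λ.B₁′ = 5dL·B₀ ≤ λ.B₁`
and the hypotheses of `b8LeafRS_subB_of_knit_lettersRDU` MINUS `p6`, PLUS — at EVERY CUBE `c : CubeB8 θ.D θ.L i.k i.Ω` ((1.131): `□ ⊂ Ω_k`, `□̃ ⊂ Ω_{k−1}`, side `M > 11d`,
collar width `ρ ≥ L`) of every member `i` with `IdxB8LawsB θ.L i` — [4]'s existence letters `SockLettersRD` and the b9 socket `SockB9P3` at every truncation AT THE CUBE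
GEOMETRY `(cubeFam, cubeLamS, cubeLamB)` with spacing `i.η` (the cube members are finite-`Ω₀` members: this is where the W8∕W8′ repair is load-bearing): there is
`c₁ > 0` (print's «there exists c₁», Prop. 6 p. 99; here depending on `d, L`, the socket constants and `λ`'s `B₀β, C₂, β, len`) such that the surviving [B8] leaf holds over
`fun j : IdxB8SubB θ => famB8OfRecordSubB θ λ.β λ.len j` with Proposition 6 read at the cube family of record `fun j : IdxB8SubB θ => cubB8OfRecord θ j.1` (=
node00-def-cube's `(λ.withCubOn (IdxB8LawsB θ.L ·.1)).cub`) and threshold `c₁`.  Proof: per cube, `SockHFP₀ ∧ SockHFP` by n05-c's `sockHFP_pair_cubeMemberRD` (n05-d's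
`exists_threshold_sockHFP_pairRD` at the cube laws), `SockH59` by `sockH59_of_allLevels`; then n05-e's `prop6Printed_zdCub₃` at `f := fun j : IdxB8SubB θ => j.1.1`,
`prop6Printed_zdCub_mono` to `λ.B₁ ≥ 5dL·B₀`, and §1's knit.  Remaining printed members: `p5e p5u p7 t8S`.  NOT a discharge of N05.
[cite: Balaban1985RegularSpaces, Prop. 6 (1.131)–(1.138) pp.98–99, Lemma 1 p.79, Thm 2 p.83, Prop. 3 p.87, Thm 4 p.88, Prop. 5 p.94; Prop. 7 p.100, Thm 8 p.101 (named hypotheses); Balaban1985BackgroundPropagators, Thm 3.1 p.397, Thm 3.3 p.398, (3.25) p.394 (the letters and the b9 socket, hypotheses)] -/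
theorem exists_c₁_b8LeafRS_subB_cut_of_knit_lettersRDU {θ : Stage3Params} (lam : ResidB8 θ) (hD : 2 ≤ θ.D) (hB₁' : lam.B₁' = 5 * (θ.D : ℝ) * θ.L * lam.inp.B₀)
    (hB₁ : 5 * (θ.D : ℝ) * θ.L * lam.inp.B₀ ≤ lam.B₁)
    {cB9 B₀'H B₂' BG BR cL : ℝ} (hB : 2 ≤ 5 * (θ.D : ℝ) * θ.L * lam.inp.B₀) (hB₀β : 0 < lam.B₀β) (hC₂ : 2097152 * ((θ.D : ℝ) + 1) ^ 2 ≤ lam.C₂)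
    (hcB9 : 0 < cB9) (hB₀'H : 0 < B₀'H) (hB₂' : 0 ≤ B₂') (hBG : 0 ≤ BG) (hBR : 0 ≤ BR) (hcL : 0 < cL)
    (hfree : 3 * (2 * (θ.D : ℝ) * (θ.L : ℝ) ^ 2) * BG * BR ≤ lam.inp.B₀')
    -- [4]'s letters at the LAW members: existence side (laws on print's domains) and uniqueness side
    (SLet : ∀ i : ZdIdx θ.D θ.L, IdxB8LawsB θ.L i → SockLettersRD (𝔸 := θ.𝔸) θ.L BG BR B₀'H B₂' cL i.η i.k i.Ω i.Λs)
    (SLetU : ∀ i : ZdIdx θ.D θ.L, IdxB8LawsB θ.L i → ∀ α₀ : ℝ, 0 < α₀ → α₀ ≤ cL → ∀ U₀ : Site θ.D → Fin θ.D → θ.𝔸ˣ, (∀ x κ, U₀ x κ ∈ unitaryUnits θ.𝔸) →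
      InAk θ.L i.k i.η α₀ i.Ω U₀ →
      ∃ (g Δ : (Site θ.D → θ.𝔸) →ₗ[ℂ] (Site θ.D → θ.𝔸)) (q : (Site θ.D → θ.𝔸) →ₗ[ℂ] (ℕ → Site θ.D → θ.𝔸))
        (qs : (ℕ → Site θ.D → θ.𝔸) →ₗ[ℂ] (Site θ.D → θ.𝔸)) (Aw c : (ℕ → Site θ.D → θ.𝔸) →ₗ[ℂ] (ℕ → Site θ.D → θ.𝔸))
        (H' : XSpace θ.D i.k θ.𝔸 →ₗ[ℂ] (Site θ.D → θ.𝔸)),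
        (∀ x, g (Δ x + qs (Aw (q x))) = x) ∧ (∀ φ, qs (c (q (g (g (qs φ))))) = qs φ) ∧
        (∀ (f : Site θ.D → θ.𝔸), ∀ x ∈ i.Ω 0, Δ f x = covLap i.η U₀ ((i.Ω 0).indicator f) x) ∧
        (∀ (μ : ℕ → Site θ.D → θ.𝔸), ∀ x ∈ i.Ω 0, qs μ x = QT θ.L i.k (i.Λs i.k) U₀ μ x) ∧
        (∀ (f : Site θ.D → θ.𝔸) (n : ℕ), n ≤ i.k → ∀ y ∈ i.Λs i.k n, q f n y = QprimeIter (zdBlocking θ.D θ.L) (bgT θ.L U₀) n f y) ∧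
        (∀ (f : Site θ.D → θ.𝔸) (n : ℕ) (y : Site θ.D), ¬ (n ≤ i.k ∧ y ∈ i.Λs i.k n) → q f n y = 0) ∧
        (∀ (X : XSpace θ.D i.k θ.𝔸) (x : Site θ.D), ‖H' X x‖ ≤ B₀'H * ‖X‖) ∧
        (∀ n, n ≤ i.k → ∀ (X : XSpace θ.D i.k θ.𝔸), ∀ p ∈ {b : Site θ.D × Fin θ.D | SideTouches (i.Ω n) b.1 b.2},
          wt θ.L i.η n * ‖covDerivFwd i.η U₀ p.2 (H' X) p.1‖ ≤ B₀'H * ‖X‖) ∧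
        (∀ X : XSpace θ.D i.k θ.𝔸, Bd2 θ.L i.η i.k i.Ω (covLap i.η U₀ (H' X)) (B₂' * ‖X‖)) ∧
        (∀ (Y : XSpace θ.D i.k θ.𝔸) (n : ℕ) (hn : n ≤ i.k) (y : Site θ.D), y ∈ i.Λs i.k n →
          QprimeIter (zdBlocking θ.D θ.L) (bgT θ.L U₀) n (H' Y) y = Y (⟨n, Nat.lt_succ_of_le hn⟩, y)) ∧
        (∀ (f : Site θ.D → θ.𝔸) (r : ℝ), 0 ≤ r → Bd2 θ.L i.η i.k i.Ω f r →
          (∀ x, ‖g f x‖ ≤ BG * r) ∧ ∀ n, n ≤ i.k → ∀ p ∈ {b : Site θ.D × Fin θ.D | SideTouches (i.Ω n) b.1 b.2},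
            wt θ.L i.η n * ‖covDerivFwd i.η U₀ p.2 (g f) p.1‖ ≤ BG * r) ∧
        (∀ (f : Site θ.D → θ.𝔸) (r : ℝ), 0 ≤ r → Bd2 θ.L i.η i.k i.Ω f r → Bd2 θ.L i.η i.k i.Ω (f - g (qs (c (q (g f))))) (BR * r)))
    (SB9all : ∀ i : ZdIdx θ.D θ.L, IdxB8LawsB θ.L i → ∀ m, m ≤ i.k →
      SockB9P3 (𝔸 := θ.𝔸) θ.L lam.inp.B₀ lam.B₀β cB9 lam.β lam.len i.η m i.Ω i.Λs i.Λb)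
    -- AT EVERY CUBE of every law member: the existence letters and the b9 socket at the CUBE geometry (finite-Ω₀ members)
    (SLetC : ∀ i : ZdIdx θ.D θ.L, IdxB8LawsB θ.L i → ∀ c : CubeB8 θ.D θ.L i.k i.Ω,
      SockLettersRD (𝔸 := θ.𝔸) θ.L BG BR B₀'H B₂' cL i.η c.k (cubeFam false θ.L c.a c.M c.ρ c.k) (cubeLamS θ.L c.a c.M c.ρ c.k))
    (SB9C : ∀ i : ZdIdx θ.D θ.L, IdxB8LawsB θ.L i → ∀ c : CubeB8 θ.D θ.L i.k i.Ω, ∀ m, m ≤ c.k →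
      SockB9P3 (𝔸 := θ.𝔸) θ.L lam.inp.B₀ lam.B₀β cB9 lam.β lam.len i.η m (cubeFam false θ.L c.a c.M c.ρ c.k) (cubeLamS θ.L c.a c.M c.ρ c.k)
        (cubeLamB θ.L c.a c.M c.ρ c.k))
    -- the four remaining printed members over the bond-law sub-index
    (p5e : B8.Prop5Exists lam.inp.B₀' lam.B₁ lam.lan) (p5u : B8.Prop5Unique lam.lan)
    (p7 : B8SectGH.Prop7PrintedR (fun j : IdxB8SubB θ => famB8OfRecordSubB θ lam.β lam.len j) (fun j => lam.toAxial j.1))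
    (t8 : B8Thm8Surviving.Thm8SurvivingAt 1 lam.B₁ lam.B₂ (fun j : IdxB8SubB θ => famB8OfRecordSubB θ lam.β lam.len j)) :
    ∃ c₁ : ℝ, 0 < c₁ ∧
      B8LeafRS θ.D (θ.L : ℝ) lam.C₂ lam.B₁' lam.inp.B₀' lam.B₁ lam.B₂ c₁ lam.inp lam.B₀β (blockPairNA θ.D θ.L θ.𝔸)
        (fun j : IdxB8SubB θ => famB8OfRecordSubB θ lam.β lam.len j) lam.lan (fun j : IdxB8SubB θ => cubB8OfRecord θ j.1) (fun j => lam.toAxial j.1) := by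
  have hd1 : 1 ≤ θ.D := le_trans (by norm_num) hD
  have hL1 : 1 ≤ θ.L := le_trans (by norm_num) θ.two_le_L
  have hB₀ := lam.inp.B₀_pos
  have hB₀' := lam.inp.B₀'_pos
  -- the per-cube Prop.-5 existence sockets from the cube letters + the cube b9 socket (n05-c, on n05-d's RD provider)
  obtain ⟨cF, hcF, HF⟩ := sockHFP_pair_cubeMemberRD (𝔸 := θ.𝔸) hD θ.two_le_L hB₀ hB₀' hB hB₀'H hB₂' hBG hBR hcB9 hcL hfree
  -- the (1.59) threshold delivered by the b9 ∃-package adapter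
  have hc59 : 0 < min cB9 (cB9 / (2 * (θ.L * (5 * (θ.D : ℝ) * θ.L * lam.inp.B₀)) + 8 * (8 * lam.inp.B₀' * (5 * (θ.D : ℝ) * θ.L * lam.inp.B₀)))) := by
    have hLpos : (0 : ℝ) < θ.L := by exact_mod_cast lt_of_lt_of_le (by norm_num) θ.two_le_L
    have hdpos : (0 : ℝ) < θ.D := by exact_mod_cast hd1
    have hden : 0 < 2 * (θ.L * (5 * (θ.D : ℝ) * θ.L * lam.inp.B₀)) + 8 * (8 * lam.inp.B₀' * (5 * (θ.D : ℝ) * θ.L * lam.inp.B₀)) := by positivity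
    exact lt_min hcB9 (div_pos hcB9 hden)
  -- Proposition 6 on the cube family of record over the bond-law sub-index (n05-e's provider at `f := fun j => j.1.1`)
  obtain ⟨c₁, hc₁, G⟩ := prop6Printed_zdCub₃ (𝔸 := θ.𝔸) hD θ.two_le_L hB₀ hB₀' hB hB₀β.le hC₂ hcF hcF hc59 hcB9 lam.β lam.len
  have p6₀ : B8.Prop6Printed θ.D (θ.L : ℝ) (5 * (θ.D : ℝ) * θ.L * lam.inp.B₀) c₁ (fun j : IdxB8SubB θ => zdCub θ.𝔸 θ.L j.1.1) := by
    refine G (fun j : IdxB8SubB θ => j.1.1) fun j c => ?_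
    obtain ⟨h₀, h₁⟩ := HF j.1.1.hη c.one_le_k c.a c.M c.L_le_ρ (SLetC j.1.1 j.2 c) (SB9C j.1.1 j.2 c)
    exact ⟨h₀, h₁, sockH59_of_allLevels (𝔸 := θ.𝔸) hd1 hL1 hB₀ hB₀'.le hcB9 (SB9C j.1.1 j.2 c), SB9C j.1.1 j.2 c c.k le_rfl⟩
  have p6 : B8.Prop6Printed θ.D (θ.L : ℝ) lam.B₁ c₁ (fun j : IdxB8SubB θ => cubB8OfRecord θ j.1) :=
    prop6Printed_zdCub_mono θ.𝔸 (fun j : IdxB8SubB θ => j.1.1) hB₁ le_rfl p6₀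
  refine ⟨c₁, hc₁, ?_⟩
  rw [hB₁']
  exact b8LeafRS_zd3_map_lettersRDU hD θ.two_le_L θ.L lam.β lam.len lam.inp hB hB₀β hC₂ hcB9 hB₀'H hB₂' hBG hBR hcL hfree
    (fun j : IdxB8SubB θ => j.1.1) (fun j => j.1.2) (fun j => IdxB8SubB.tower_all j) (fun j => j.2.trunc_lt) (fun j => j.2.trunc_top)
    (fun j => SLet j.1.1 j.2) (fun j => SLetU j.1.1 j.2) (fun j => SB9all j.1.1 j.2) p5e p5u p6 p7 t8

end KnitSubBCube

#print axioms b8LeafRS_subB_of_knit_lettersRDU_bonds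
#print axioms exists_c₁_b8LeafRS_subB_cut_of_knit_lettersRDU

/-! ## §3 (v1.2) The same two knits with the UNIQUENESS letters' left-inverse law of `G′` asked on BOUNDED functions (the W8″ guard)

WHY (seat `pub-ymgap-dag-n05-d` g3, 2026-08-27; APPEND-ONLY, §§1–2 byte-identical).  §§1–2's binder `SLetU` displays `G′` through the TOTAL law
`∀ x, G′(Δx + Q′ᵀ𝔄Q′x) = x` on all functions `ℤᵈ → 𝔸`; at the members the knit ranges over (`Ω 0 = univ`) the readings pin `Δ′` everywhere and the
`Lᵏ`-periodic finite-range `Δ′` has unbounded null vectors, so §§1–2 are vacuous on the uniqueness side as typed (this seat's W8″; dag-ref-A READ-24 (4)).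
§3 re-types conjunct 1 to its printed domain ([Balaban1985BackgroundPropagators] Thm 3.1 p. 397: `G′ = (Δ′_{Ω₀})⁻¹` on bounded functions) and re-runs
the two knits on `B8LeafKnitZd3LettersRDB` / `B8SockP5uEAssemblyB` / `B8Prop5UniqSectEW` / `B8Prop5UniqKLevelB` (all kernel-landed).  Count-neutral;
N05 NOT discharged. -/

section KnitSubBGuarded

open Literature.MathematicalPhysics.QuantumFieldTheory.Balaban1983to89.B8LeafKnitZd3LettersRDB (b8LeafRS_zd3_map_lettersRDUB)
open Literature.MathematicalPhysics.QuantumFieldTheory.Balaban1983to89.B8Eq131CubesAdmissible (cubeFam)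
open Literature.MathematicalPhysics.QuantumFieldTheory.Balaban1983to89.B8CubeMemberZd (cubeLamS cubeLamB)
open Literature.MathematicalPhysics.QuantumFieldTheory.Balaban1983to89.B8SockHFPCubeMemberRD (sockHFP_pair_cubeMemberRD)
open Literature.MathematicalPhysics.QuantumFieldTheory.Balaban1983to89.B8Prop6CubeMemberGauged (prop6Printed_zdCub₃)
open Literature.MathematicalPhysics.QuantumFieldTheory.Balaban1983to89.B8LeafSocketsB9 (sockH59_of_allLevels)

/-- **(v1.2) THE SURVIVING [B8] LEAF OVER THE BOND-LAW SUB-INDEX OF RECORD FROM [4]'s LETTERS, UNIQUENESS LETTERS GUARDED** — §1's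
`b8LeafRS_subB_of_knit_lettersRDU` VERBATIM except that conjunct 1 of the uniqueness-letters binder `SLetUB` is [4]'s left-inverse law of `G′` ON BOUNDED
FUNCTIONS (`∀ x, (∃ C, ∀ y, ‖x y‖ ≤ C) → G′(Δx + Q′ᵀ𝔄Q′x) = x`, Thm 3.1 p. 397 as printed; the total law has no model at `Ω 0 = univ` — this seat's W8″ — so
THIS is the non-vacuous form of §1), via `B8LeafKnitZd3LettersRDB.b8LeafRS_zd3_map_lettersRDUB`.  NOT a discharge of N05.
[cite: Balaban1985RegularSpaces, Lemma 1 p.79, Thm 2 p.83, Prop. 3 p.87, Thm 4 p.88, Prop. 5 (1.106)–(1.109) p.94; Prop. 6 p.99, Prop. 7 p.100, Thm 8 p.101 (named hypotheses); Balaban1985BackgroundPropagators, Thm 3.1 p.397, (3.25) p.394, Thms 3.2–3.3 pp.397–398 (the letters, hypotheses)] -/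
theorem b8LeafRS_subB_of_knit_lettersRDUB {θ : Stage3Params} (lam : ResidB8 θ) (hD : 2 ≤ θ.D) (hB₁' : lam.B₁' = 5 * (θ.D : ℝ) * θ.L * lam.inp.B₀)
    {cB9 B₀'H B₂' BG BR cL : ℝ} (hB : 2 ≤ 5 * (θ.D : ℝ) * θ.L * lam.inp.B₀) (hB₀β : 0 < lam.B₀β) (hC₂ : 2097152 * ((θ.D : ℝ) + 1) ^ 2 ≤ lam.C₂)
    (hcB9 : 0 < cB9) (hB₀'H : 0 < B₀'H) (hB₂' : 0 ≤ B₂') (hBG : 0 ≤ BG) (hBR : 0 ≤ BR) (hcL : 0 < cL)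
    (hfree : 3 * (2 * (θ.D : ℝ) * (θ.L : ℝ) ^ 2) * BG * BR ≤ lam.inp.B₀')
    -- [4]'s letters at the LAW members only: existence side (laws on print's domains) and uniqueness side (n04-b's twelve laws at the top structure)
    (SLet : ∀ i : ZdIdx θ.D θ.L, IdxB8LawsB θ.L i → SockLettersRD (𝔸 := θ.𝔸) θ.L BG BR B₀'H B₂' cL i.η i.k i.Ω i.Λs)
    (SLetUB : ∀ i : ZdIdx θ.D θ.L, IdxB8LawsB θ.L i → ∀ α₀ : ℝ, 0 < α₀ → α₀ ≤ cL → ∀ U₀ : Site θ.D → Fin θ.D → θ.𝔸ˣ, (∀ x κ, U₀ x κ ∈ unitaryUnits θ.𝔸) →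
      InAk θ.L i.k i.η α₀ i.Ω U₀ →
      ∃ (g Δ : (Site θ.D → θ.𝔸) →ₗ[ℂ] (Site θ.D → θ.𝔸)) (q : (Site θ.D → θ.𝔸) →ₗ[ℂ] (ℕ → Site θ.D → θ.𝔸))
        (qs : (ℕ → Site θ.D → θ.𝔸) →ₗ[ℂ] (Site θ.D → θ.𝔸)) (Aw c : (ℕ → Site θ.D → θ.𝔸) →ₗ[ℂ] (ℕ → Site θ.D → θ.𝔸))
        (H' : XSpace θ.D i.k θ.𝔸 →ₗ[ℂ] (Site θ.D → θ.𝔸)),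
        (∀ x : Site θ.D → θ.𝔸, (∃ C : ℝ, ∀ y, ‖x y‖ ≤ C) → g (Δ x + qs (Aw (q x))) = x) ∧ (∀ φ, qs (c (q (g (g (qs φ))))) = qs φ) ∧
        (∀ (f : Site θ.D → θ.𝔸), ∀ x ∈ i.Ω 0, Δ f x = covLap i.η U₀ ((i.Ω 0).indicator f) x) ∧
        (∀ (μ : ℕ → Site θ.D → θ.𝔸), ∀ x ∈ i.Ω 0, qs μ x = QT θ.L i.k (i.Λs i.k) U₀ μ x) ∧
        (∀ (f : Site θ.D → θ.𝔸) (n : ℕ), n ≤ i.k → ∀ y ∈ i.Λs i.k n, q f n y = QprimeIter (zdBlocking θ.D θ.L) (bgT θ.L U₀) n f y) ∧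
        (∀ (f : Site θ.D → θ.𝔸) (n : ℕ) (y : Site θ.D), ¬ (n ≤ i.k ∧ y ∈ i.Λs i.k n) → q f n y = 0) ∧
        (∀ (X : XSpace θ.D i.k θ.𝔸) (x : Site θ.D), ‖H' X x‖ ≤ B₀'H * ‖X‖) ∧
        (∀ n, n ≤ i.k → ∀ (X : XSpace θ.D i.k θ.𝔸), ∀ p ∈ {b : Site θ.D × Fin θ.D | SideTouches (i.Ω n) b.1 b.2},
          wt θ.L i.η n * ‖covDerivFwd i.η U₀ p.2 (H' X) p.1‖ ≤ B₀'H * ‖X‖) ∧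
        (∀ X : XSpace θ.D i.k θ.𝔸, Bd2 θ.L i.η i.k i.Ω (covLap i.η U₀ (H' X)) (B₂' * ‖X‖)) ∧
        (∀ (Y : XSpace θ.D i.k θ.𝔸) (n : ℕ) (hn : n ≤ i.k) (y : Site θ.D), y ∈ i.Λs i.k n →
          QprimeIter (zdBlocking θ.D θ.L) (bgT θ.L U₀) n (H' Y) y = Y (⟨n, Nat.lt_succ_of_le hn⟩, y)) ∧
        (∀ (f : Site θ.D → θ.𝔸) (r : ℝ), 0 ≤ r → Bd2 θ.L i.η i.k i.Ω f r →
          (∀ x, ‖g f x‖ ≤ BG * r) ∧ ∀ n, n ≤ i.k → ∀ p ∈ {b : Site θ.D × Fin θ.D | SideTouches (i.Ω n) b.1 b.2},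
            wt θ.L i.η n * ‖covDerivFwd i.η U₀ p.2 (g f) p.1‖ ≤ BG * r) ∧
        (∀ (f : Site θ.D → θ.𝔸) (r : ℝ), 0 ≤ r → Bd2 θ.L i.η i.k i.Ω f r → Bd2 θ.L i.η i.k i.Ω (f - g (qs (c (q (g f))))) (BR * r)))
    -- the b9 socket at every truncation, at the LAW members only ([4] Thm 3.3 in Prop. 3's frame; the bond classes are generated by the tower there)
    (SB9all : ∀ i : ZdIdx θ.D θ.L, IdxB8LawsB θ.L i → ∀ m, m ≤ i.k →
      SockB9P3 (𝔸 := θ.𝔸) θ.L lam.inp.B₀ lam.B₀β cB9 lam.β lam.len i.η m i.Ω i.Λs i.Λb)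
    -- the five printed members over the bond-law sub-index
    (p5e : B8.Prop5Exists lam.inp.B₀' lam.B₁ lam.lan) (p5u : B8.Prop5Unique lam.lan) (p6 : B8.Prop6Printed θ.D (θ.L : ℝ) lam.B₁ lam.c₁ lam.cub)
    (p7 : B8SectGH.Prop7PrintedR (fun j : IdxB8SubB θ => famB8OfRecordSubB θ lam.β lam.len j) (fun j => lam.toAxial j.1))
    (t8 : B8Thm8Surviving.Thm8SurvivingAt 1 lam.B₁ lam.B₂ (fun j : IdxB8SubB θ => famB8OfRecordSubB θ lam.β lam.len j)) :
    B8LeafRS θ.D (θ.L : ℝ) lam.C₂ lam.B₁' lam.inp.B₀' lam.B₁ lam.B₂ lam.c₁ lam.inp lam.B₀β (blockPairNA θ.D θ.L θ.𝔸)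
      (fun j : IdxB8SubB θ => famB8OfRecordSubB θ lam.β lam.len j) lam.lan lam.cub (fun j => lam.toAxial j.1) := by
  rw [hB₁']
  exact b8LeafRS_zd3_map_lettersRDUB hD θ.two_le_L θ.L lam.β lam.len lam.inp hB hB₀β hC₂ hcB9 hB₀'H hB₂' hBG hBR hcL hfree
    (fun j : IdxB8SubB θ => j.1.1) (fun j => j.1.2) (fun j => IdxB8SubB.tower_all j) (fun j => j.2.trunc_lt) (fun j => j.2.trunc_top)
    (fun j => SLet j.1.1 j.2) (fun j => SLetUB j.1.1 j.2) (fun j => SB9all j.1.1 j.2) p5e p5u p6 p7 t8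

/-- **(v1.2) THE N05 KNIT OVER THE BOND-LAW SUB-INDEX WITH PROPOSITION 6 DISCHARGED AT THE LAW-CUT CUBE SLOT, UNIQUENESS LETTERS GUARDED** — §2's
`exists_c₁_b8LeafRS_subB_cut_of_knit_lettersRDU` VERBATIM except conjunct 1 of `SLetUB` (left-inverse law of `G′` on bounded functions only; W8″), via
`b8LeafRS_zd3_map_lettersRDUB`; per cube the existence sockets as in §2 (`sockHFP_pair_cubeMemberRD`, `sockH59_of_allLevels`, `prop6Printed_zdCub₃`,
`prop6Printed_zdCub_mono`).  Remaining printed members: `p5e p5u p7 t8S`.  NOT a discharge of N05.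
[cite: Balaban1985RegularSpaces, Prop. 6 (1.131)–(1.138) pp.98–99, Lemma 1 p.79, Thm 2 p.83, Prop. 3 p.87, Thm 4 p.88, Prop. 5 p.94; Prop. 7 p.100, Thm 8 p.101 (named hypotheses); Balaban1985BackgroundPropagators, Thm 3.1 p.397, Thm 3.3 p.398, (3.25) p.394 (the letters and the b9 socket, hypotheses)] -/
theorem exists_c₁_b8LeafRS_subB_cut_of_knit_lettersRDUB {θ : Stage3Params} (lam : ResidB8 θ) (hD : 2 ≤ θ.D) (hB₁' : lam.B₁' = 5 * (θ.D : ℝ) * θ.L * lam.inp.B₀)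
    (hB₁ : 5 * (θ.D : ℝ) * θ.L * lam.inp.B₀ ≤ lam.B₁)
    {cB9 B₀'H B₂' BG BR cL : ℝ} (hB : 2 ≤ 5 * (θ.D : ℝ) * θ.L * lam.inp.B₀) (hB₀β : 0 < lam.B₀β) (hC₂ : 2097152 * ((θ.D : ℝ) + 1) ^ 2 ≤ lam.C₂)
    (hcB9 : 0 < cB9) (hB₀'H : 0 < B₀'H) (hB₂' : 0 ≤ B₂') (hBG : 0 ≤ BG) (hBR : 0 ≤ BR) (hcL : 0 < cL)
    (hfree : 3 * (2 * (θ.D : ℝ) * (θ.L : ℝ) ^ 2) * BG * BR ≤ lam.inp.B₀')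
    -- [4]'s letters at the LAW members: existence side (laws on print's domains) and uniqueness side
    (SLet : ∀ i : ZdIdx θ.D θ.L, IdxB8LawsB θ.L i → SockLettersRD (𝔸 := θ.𝔸) θ.L BG BR B₀'H B₂' cL i.η i.k i.Ω i.Λs)
    (SLetUB : ∀ i : ZdIdx θ.D θ.L, IdxB8LawsB θ.L i → ∀ α₀ : ℝ, 0 < α₀ → α₀ ≤ cL → ∀ U₀ : Site θ.D → Fin θ.D → θ.𝔸ˣ, (∀ x κ, U₀ x κ ∈ unitaryUnits θ.𝔸) →
      InAk θ.L i.k i.η α₀ i.Ω U₀ →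
      ∃ (g Δ : (Site θ.D → θ.𝔸) →ₗ[ℂ] (Site θ.D → θ.𝔸)) (q : (Site θ.D → θ.𝔸) →ₗ[ℂ] (ℕ → Site θ.D → θ.𝔸))
        (qs : (ℕ → Site θ.D → θ.𝔸) →ₗ[ℂ] (Site θ.D → θ.𝔸)) (Aw c : (ℕ → Site θ.D → θ.𝔸) →ₗ[ℂ] (ℕ → Site θ.D → θ.𝔸))
        (H' : XSpace θ.D i.k θ.𝔸 →ₗ[ℂ] (Site θ.D → θ.𝔸)),
        (∀ x : Site θ.D → θ.𝔸, (∃ C : ℝ, ∀ y, ‖x y‖ ≤ C) → g (Δ x + qs (Aw (q x))) = x) ∧ (∀ φ, qs (c (q (g (g (qs φ))))) = qs φ) ∧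
        (∀ (f : Site θ.D → θ.𝔸), ∀ x ∈ i.Ω 0, Δ f x = covLap i.η U₀ ((i.Ω 0).indicator f) x) ∧
        (∀ (μ : ℕ → Site θ.D → θ.𝔸), ∀ x ∈ i.Ω 0, qs μ x = QT θ.L i.k (i.Λs i.k) U₀ μ x) ∧
        (∀ (f : Site θ.D → θ.𝔸) (n : ℕ), n ≤ i.k → ∀ y ∈ i.Λs i.k n, q f n y = QprimeIter (zdBlocking θ.D θ.L) (bgT θ.L U₀) n f y) ∧
        (∀ (f : Site θ.D → θ.𝔸) (n : ℕ) (y : Site θ.D), ¬ (n ≤ i.k ∧ y ∈ i.Λs i.k n) → q f n y = 0) ∧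
        (∀ (X : XSpace θ.D i.k θ.𝔸) (x : Site θ.D), ‖H' X x‖ ≤ B₀'H * ‖X‖) ∧
        (∀ n, n ≤ i.k → ∀ (X : XSpace θ.D i.k θ.𝔸), ∀ p ∈ {b : Site θ.D × Fin θ.D | SideTouches (i.Ω n) b.1 b.2},
          wt θ.L i.η n * ‖covDerivFwd i.η U₀ p.2 (H' X) p.1‖ ≤ B₀'H * ‖X‖) ∧
        (∀ X : XSpace θ.D i.k θ.𝔸, Bd2 θ.L i.η i.k i.Ω (covLap i.η U₀ (H' X)) (B₂' * ‖X‖)) ∧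
        (∀ (Y : XSpace θ.D i.k θ.𝔸) (n : ℕ) (hn : n ≤ i.k) (y : Site θ.D), y ∈ i.Λs i.k n →
          QprimeIter (zdBlocking θ.D θ.L) (bgT θ.L U₀) n (H' Y) y = Y (⟨n, Nat.lt_succ_of_le hn⟩, y)) ∧
        (∀ (f : Site θ.D → θ.𝔸) (r : ℝ), 0 ≤ r → Bd2 θ.L i.η i.k i.Ω f r →
          (∀ x, ‖g f x‖ ≤ BG * r) ∧ ∀ n, n ≤ i.k → ∀ p ∈ {b : Site θ.D × Fin θ.D | SideTouches (i.Ω n) b.1 b.2},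
            wt θ.L i.η n * ‖covDerivFwd i.η U₀ p.2 (g f) p.1‖ ≤ BG * r) ∧
        (∀ (f : Site θ.D → θ.𝔸) (r : ℝ), 0 ≤ r → Bd2 θ.L i.η i.k i.Ω f r → Bd2 θ.L i.η i.k i.Ω (f - g (qs (c (q (g f))))) (BR * r)))
    (SB9all : ∀ i : ZdIdx θ.D θ.L, IdxB8LawsB θ.L i → ∀ m, m ≤ i.k →
      SockB9P3 (𝔸 := θ.𝔸) θ.L lam.inp.B₀ lam.B₀β cB9 lam.β lam.len i.η m i.Ω i.Λs i.Λb)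
    -- AT EVERY CUBE of every law member: the existence letters and the b9 socket at the CUBE geometry (finite-Ω₀ members)
    (SLetC : ∀ i : ZdIdx θ.D θ.L, IdxB8LawsB θ.L i → ∀ c : CubeB8 θ.D θ.L i.k i.Ω,
      SockLettersRD (𝔸 := θ.𝔸) θ.L BG BR B₀'H B₂' cL i.η c.k (cubeFam false θ.L c.a c.M c.ρ c.k) (cubeLamS θ.L c.a c.M c.ρ c.k))
    (SB9C : ∀ i : ZdIdx θ.D θ.L, IdxB8LawsB θ.L i → ∀ c : CubeB8 θ.D θ.L i.k i.Ω, ∀ m, m ≤ c.k →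
      SockB9P3 (𝔸 := θ.𝔸) θ.L lam.inp.B₀ lam.B₀β cB9 lam.β lam.len i.η m (cubeFam false θ.L c.a c.M c.ρ c.k) (cubeLamS θ.L c.a c.M c.ρ c.k)
        (cubeLamB θ.L c.a c.M c.ρ c.k))
    -- the four remaining printed members over the bond-law sub-index
    (p5e : B8.Prop5Exists lam.inp.B₀' lam.B₁ lam.lan) (p5u : B8.Prop5Unique lam.lan)
    (p7 : B8SectGH.Prop7PrintedR (fun j : IdxB8SubB θ => famB8OfRecordSubB θ lam.β lam.len j) (fun j => lam.toAxial j.1))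
    (t8 : B8Thm8Surviving.Thm8SurvivingAt 1 lam.B₁ lam.B₂ (fun j : IdxB8SubB θ => famB8OfRecordSubB θ lam.β lam.len j)) :
    ∃ c₁ : ℝ, 0 < c₁ ∧
      B8LeafRS θ.D (θ.L : ℝ) lam.C₂ lam.B₁' lam.inp.B₀' lam.B₁ lam.B₂ c₁ lam.inp lam.B₀β (blockPairNA θ.D θ.L θ.𝔸)
        (fun j : IdxB8SubB θ => famB8OfRecordSubB θ lam.β lam.len j) lam.lan (fun j : IdxB8SubB θ => cubB8OfRecord θ j.1) (fun j => lam.toAxial j.1) := by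
  have hd1 : 1 ≤ θ.D := le_trans (by norm_num) hD
  have hL1 : 1 ≤ θ.L := le_trans (by norm_num) θ.two_le_L
  have hB₀ := lam.inp.B₀_pos
  have hB₀' := lam.inp.B₀'_pos
  -- the per-cube Prop.-5 existence sockets from the cube letters + the cube b9 socket (n05-c, on n05-d's RD provider)
  obtain ⟨cF, hcF, HF⟩ := sockHFP_pair_cubeMemberRD (𝔸 := θ.𝔸) hD θ.two_le_L hB₀ hB₀' hB hB₀'H hB₂' hBG hBR hcB9 hcL hfree
  -- the (1.59) threshold delivered by the b9 ∃-package adapter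
  have hc59 : 0 < min cB9 (cB9 / (2 * (θ.L * (5 * (θ.D : ℝ) * θ.L * lam.inp.B₀)) + 8 * (8 * lam.inp.B₀' * (5 * (θ.D : ℝ) * θ.L * lam.inp.B₀)))) := by
    have hLpos : (0 : ℝ) < θ.L := by exact_mod_cast lt_of_lt_of_le (by norm_num) θ.two_le_L
    have hdpos : (0 : ℝ) < θ.D := by exact_mod_cast hd1
    have hden : 0 < 2 * (θ.L * (5 * (θ.D : ℝ) * θ.L * lam.inp.B₀)) + 8 * (8 * lam.inp.B₀' * (5 * (θ.D : ℝ) * θ.L * lam.inp.B₀)) := by positivity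
    exact lt_min hcB9 (div_pos hcB9 hden)
  -- Proposition 6 on the cube family of record over the bond-law sub-index (n05-e's provider at `f := fun j => j.1.1`)
  obtain ⟨c₁, hc₁, G⟩ := prop6Printed_zdCub₃ (𝔸 := θ.𝔸) hD θ.two_le_L hB₀ hB₀' hB hB₀β.le hC₂ hcF hcF hc59 hcB9 lam.β lam.len
  have p6₀ : B8.Prop6Printed θ.D (θ.L : ℝ) (5 * (θ.D : ℝ) * θ.L * lam.inp.B₀) c₁ (fun j : IdxB8SubB θ => zdCub θ.𝔸 θ.L j.1.1) := by
    refine G (fun j : IdxB8SubB θ => j.1.1) fun j c => ?_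
    obtain ⟨h₀, h₁⟩ := HF j.1.1.hη c.one_le_k c.a c.M c.L_le_ρ (SLetC j.1.1 j.2 c) (SB9C j.1.1 j.2 c)
    exact ⟨h₀, h₁, sockH59_of_allLevels (𝔸 := θ.𝔸) hd1 hL1 hB₀ hB₀'.le hcB9 (SB9C j.1.1 j.2 c), SB9C j.1.1 j.2 c c.k le_rfl⟩
  have p6 : B8.Prop6Printed θ.D (θ.L : ℝ) lam.B₁ c₁ (fun j : IdxB8SubB θ => cubB8OfRecord θ j.1) :=
    prop6Printed_zdCub_mono θ.𝔸 (fun j : IdxB8SubB θ => j.1.1) hB₁ le_rfl p6₀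
  refine ⟨c₁, hc₁, ?_⟩
  rw [hB₁']
  exact b8LeafRS_zd3_map_lettersRDUB hD θ.two_le_L θ.L lam.β lam.len lam.inp hB hB₀β hC₂ hcB9 hB₀'H hB₂' hBG hBR hcL hfree
    (fun j : IdxB8SubB θ => j.1.1) (fun j => j.1.2) (fun j => IdxB8SubB.tower_all j) (fun j => j.2.trunc_lt) (fun j => j.2.trunc_top)
    (fun j => SLet j.1.1 j.2) (fun j => SLetUB j.1.1 j.2) (fun j => SB9all j.1.1 j.2) p5e p5u p6 p7 t8

end KnitSubBGuarded

#print axioms b8LeafRS_subB_of_knit_lettersRDUB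
#print axioms exists_c₁_b8LeafRS_subB_cut_of_knit_lettersRDUB

end Summit.QuantumFields.YangMills.BalabanUVNodes.N05SubBKnit

end
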